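import Summits.CriticalPhenomena.PercolationContinuityZ3.Theorems.PercNearOneGluingNoHeavyPcintUFibBipCheck
import HarnessLib

/-!
# PCINT lane, T-fibre route PHASE 2, instance `d = 5`: `p_c^site(ℤ^5) ≤ 0.3397` via `𝕋 × K_{4,4}`

Cell `prim-pcint`, seat `prim-pcint-1` (gen 12); memo `run/shared/lean/prim/pcint/T-FIBRE-ROUTE.md` (PHASE 2).

The fibre graph is the complete bipartite graph `K_{4,4} = Cay(ℤ_{8}, odd residues)` realised as
`UFib.bipGraph (evens8)` on `ZMod 8`; the linear map `ℤ^5 → ℤ² × ZMod 8`,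
`z ↦ ((z₀ + z₂, z₁ − z₂), Σ_t (2t+1)·z_{3+t} mod 8)`, sends the `10` neighbours of `z` ONTO the neighbours of its image
(`±e₀, ±e₁, ±e₂ ↦` the six directions of `𝕋`; `±e_{3+t} ↦ ±(2t+1)`, and the odd residues mod `8` are exactly
`{±1, ±3, …, ±3}`), so `p_c^site(ℤ^5) ≤ p_c^site(𝕋 × K_{4,4})` (Lyons–Peres Thm. 6.47, site version, as in
`…PcintTFibGraph.lean`).  The usable-set comparison (`UFib.siteCriticalProb_lfib_le_of_table` with the sound rule
`UFib.bipRule` and the kernel-checked table `UFib.checkBip 4 4 (3397/10000) (5001/10000)`) gives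
`p_c^site(𝕋 × K_{4,4}) ≤ 0.3397`, hence **`UFib.siteCriticalProb_Z5_le_3397` : `p_c^site(ℤ^5) ≤ 0.3397`** and the
monotone-in-`d` version.
-/

noncomputable section

namespace Summit.CriticalPhenomena.PercolationContinuityZ3.Theorems.Pcint

namespace UFib

open Finset AdaptDom TFib Literature.Probability.Percolation Literature.Probability.LatticeModels
  LyonsPeres647Multi LyonsPeres647Site

/-! ### The fibre `K_{4,4}` on `ZMod 8` -/

/-- The even residues of `ZMod 8` (one side of `K_{4,4}`). -/
def evens8 : Finset (ZMod 8) := univ.filter fun c => c.val % 2 = 0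

/-- The neighbours of a cell in `K_{4,4} = Cay(ℤ_{8}, odd)` are its translates by the odd residues `±1, ±3, …`. -/
theorem bipGraph_evens8_adj {i j : ZMod 8} (h : (bipGraph evens8).Adj i j) :
    j = i + 1 ∨ j = i - 1 ∨ j = i + 3 ∨ j = i - 3 := by
  revert i j h; decide

/-- `#evens8 = 4`. -/
theorem card_evens8 : (evens8).card = 4 := by decide

/-- `#(evens8)ᶜ = 4`. -/
theorem card_evens8_compl : (evens8)ᶜ.card = 4 := by decide

/-- `0` is even and `1` is odd in `ZMod 8`. -/
theorem zero_mem_evens8 : (0 : ZMod 8) ∈ evens8 ∧ (1 : ZMod 8) ∉ evens8 := by decide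

/-- The sound usable-set rule of `K_{4,4}` with root cell `0`. -/
def rule8 : RuleData (bipGraph evens8) := bipRule evens8 0 zero_mem_evens8.1 1 zero_mem_evens8.2

/-! ### The covering `ℤ^5 → 𝕋 × K_{4,4}` -/

/-- **The projection `ℤ^5 → 𝕋 × K_{4,4}` is a weak covering map**: the `10` neighbours of `x` are mapped onto the
neighbours of its image. [cite: LyonsPeres2016, §6.9 Thm. 6.47 (weak covering map hypothesis)] -/
theorem surjOn_neighborSet_proj5 (x : Site 5) :
    Set.SurjOn (fun z : Site 5 => ((![z 0 + z 2, z 1 - z 2] : Site 2), ((z 3 : ℤ) : ZMod 8) + 3 * ((z 4 : ℤ) : ZMod 8)))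
      ((zdGraph 5).neighborSet x)
      ((lfib (bipGraph evens8)).neighborSet ((![x 0 + x 2, x 1 - x 2] : Site 2), ((x 3 : ℤ) : ZMod 8) + 3 * ((x 4 : ℤ) : ZMod 8))) := by
  intro yj hy
  obtain ⟨y, j⟩ := yj
  rw [SimpleGraph.mem_neighborSet, lfib_adj] at hy
  have hplus := add_single_mem_neighborSet x
  have hminus := sub_single_mem_neighborSet x
  have hy_of : ∀ z : Site 5, z 0 + z 2 = y 0 → z 1 - z 2 = y 1 → ((z 3 : ℤ) : ZMod 8) + 3 * ((z 4 : ℤ) : ZMod 8) = j →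
      (fun z : Site 5 => ((![z 0 + z 2, z 1 - z 2] : Site 2), ((z 3 : ℤ) : ZMod 8) + 3 * ((z 4 : ℤ) : ZMod 8))) z = (y, j) := by
    intro z h0 h1 h3
    simp only [Prod.mk.injEq]
    refine ⟨?_, h3⟩
    ext i; fin_cases i
    · simpa using h0
    · simpa using h1
  rcases hy with ⟨hadj, hj⟩ | ⟨heq, hj⟩
  · -- planar move, same fibre coordinate
    simp only at hadj hj
    have hd := diff_of_triGraph_adj hadj
    simp only [Matrix.cons_val_zero, Matrix.cons_val_one] at hd
    rcases hd with ⟨h0, h1⟩ | ⟨h0, h1⟩ | ⟨h0, h1⟩ | ⟨h0, h1⟩ | ⟨h0, h1⟩ | ⟨h0, h1⟩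
    · exact ⟨x + Pi.single 0 1, hplus 0, hy_of _ (by simp; omega) (by simp; omega) (by simpa using hj)⟩
    · exact ⟨x - Pi.single 0 1, hminus 0, hy_of _ (by simp; omega) (by simp; omega) (by simpa using hj)⟩
    · exact ⟨x + Pi.single 1 1, hplus 1, hy_of _ (by simp; omega) (by simp; omega) (by simpa using hj)⟩
    · exact ⟨x - Pi.single 1 1, hminus 1, hy_of _ (by simp; omega) (by simp; omega) (by simpa using hj)⟩
    · exact ⟨x + Pi.single 2 1, hplus 2, hy_of _ (by simp; omega) (by simp; omega) (by simpa using hj)⟩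
    · exact ⟨x - Pi.single 2 1, hminus 2, hy_of _ (by simp; omega) (by simp; omega) (by simpa using hj)⟩
  · -- fibre move, same planar point
    simp only at heq hj
    have h0 : x 0 + x 2 = y 0 := by have := congrFun heq 0; simpa using this
    have h1 : x 1 - x 2 = y 1 := by have := congrFun heq 1; simpa using this
    rcases bipGraph_evens8_adj hj with hj' | hj' | hj' | hj'
    · exact ⟨x + Pi.single 3 1, hplus 3, hy_of _ (by simp; omega) (by simp; omega) (by simp [hj']; ring)⟩
    · exact ⟨x - Pi.single 3 1, hminus 3, hy_of _ (by simp; omega) (by simp; omega) (by simp [hj']; ring)⟩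
    · exact ⟨x + Pi.single 4 1, hplus 4, hy_of _ (by simp; omega) (by simp; omega) (by simp [hj']; ring)⟩
    · exact ⟨x - Pi.single 4 1, hminus 4, hy_of _ (by simp; omega) (by simp; omega) (by simp [hj']; ring)⟩

/-- The projection `ℤ^5 → 𝕋 × K_{4,4}` has the `1`-fold lifting property. [cite: LyonsPeres2016, §6.9 Thm. 6.47 (weak covering map)] -/
theorem multiLift_proj5 :
    MultiLift (zdGraph 5) (lfib (bipGraph evens8))
      (fun z : Site 5 => ((![z 0 + z 2, z 1 - z 2] : Site 2), ((z 3 : ℤ) : ZMod 8) + 3 * ((z 4 : ℤ) : ZMod 8))) 1 :=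
  AxisGrouping.multiLift_one_of_surjOn surjOn_neighborSet_proj5

/-- **`p_c^site(ℤ^5) ≤ p_c^site(𝕋 × K_{4,4})`** (site covering theorem). [cite: LyonsPeres2016, §6.9 Thm. 6.47 (site version)] -/
theorem siteCriticalProb_Z5_le_lfib :
    siteCriticalProb (zdGraph 5) (0 : Site 5) ≤ siteCriticalProb (lfib (bipGraph evens8)) ((0 : Site 2), (0 : ZMod 8)) := by
  have h0 : ((![(0 : Site 5) 0 + (0 : Site 5) 2, (0 : Site 5) 1 - (0 : Site 5) 2] : Site 2),
      ((( 0 : Site 5) 3 : ℤ) : ZMod 8) + 3 * (((0 : Site 5) 4 : ℤ) : ZMod 8)) = ((0 : Site 2), (0 : ZMod 8)) := by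
    simp only [Prod.mk.injEq]
    refine ⟨?_, by simp⟩
    ext i; fin_cases i <;> simp
  refine le_of_forall_gt_imp_ge_of_dense fun t ht => ?_
  by_cases ht1 : t ≤ 1
  · have ht0 : 0 ≤ t := (siteCriticalProb_mem_Icc (lfib (bipGraph evens8)) ((0 : Site 2), (0 : ZMod 8))).1.trans ht.le
    exact siteCriticalProb_le_of_multiLift (zdGraph 5) (lfib (bipGraph evens8)) _ 1 multiLift_proj5 0 ⟨t, ht0, ht1⟩
      (by rw [h0, StarCoins.coe_orParam]; simpa using ht)
  · exact (siteCriticalProb_mem_Icc _ _).2.trans (le_of_not_ge ht1)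

/-! ### The table and the cell -/

/-- Row `ha = 0` of the tail table of `K_{4,4}` at `p = 0.3397` (kernel, exact rational arithmetic). -/
theorem checkRow_5_0 : checkRow 4 4 0 (3397 / 10000) (5001 / 10000) = true := by decide +kernel

/-- Row `ha = 1` of the tail table of `K_{4,4}` at `p = 0.3397` (kernel, exact rational arithmetic). -/
theorem checkRow_5_1 : checkRow 4 4 1 (3397 / 10000) (5001 / 10000) = true := by decide +kernel

/-- Row `ha = 2` of the tail table of `K_{4,4}` at `p = 0.3397` (kernel, exact rational arithmetic). -/
theorem checkRow_5_2 : checkRow 4 4 2 (3397 / 10000) (5001 / 10000) = true := by decide +kernel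

/-- Row `ha = 3` of the tail table of `K_{4,4}` at `p = 0.3397` (kernel, exact rational arithmetic). -/
theorem checkRow_5_3 : checkRow 4 4 3 (3397 / 10000) (5001 / 10000) = true := by decide +kernel

/-- Row `ha = 4` of the tail table of `K_{4,4}` at `p = 0.3397` (kernel, exact rational arithmetic). -/
theorem checkRow_5_4 : checkRow 4 4 4 (3397 / 10000) (5001 / 10000) = true := by decide +kernel

/-- **The tail table of `K_{4,4}` at `p = 0.3397`, `s = 0.5001`**, checked by the kernel in exact rational arithmetic. -/
theorem checkBip_5 : checkBip 4 4 (3397 / 10000) (5001 / 10000) = true :=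
  checkBip_of_rows fun ha hha => by
    interval_cases ha
    exacts [checkRow_5_0, checkRow_5_1, checkRow_5_2, checkRow_5_3, checkRow_5_4]

/-- **`p_c^site(𝕋 × K_{4,4}) ≤ 0.3397`.** -/
theorem siteCriticalProb_lfib5_le :
    siteCriticalProb (lfib (bipGraph evens8)) ((0 : Site 2), (0 : ZMod 8)) ≤ 3397 / 10000 := by
  have hchk : checkBip (evens8).card (evens8)ᶜ.card ((3397 : ℚ) / 10000) (5001 / 10000) = true := by
    rw [card_evens8, card_evens8_compl]; exact checkBip_5
  have htab := table_of_checkBip evens8 hchk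
  have hp : ((((3397 : ℚ) / 10000 : ℚ) : ℝ)) = (3397 : ℝ) / 10000 := by push_cast; ring
  have hs : ((((5001 : ℚ) / 10000 : ℚ) : ℝ)) = (5001 : ℝ) / 10000 := by push_cast; ring
  rw [hp, hs] at htab
  have h := siteCriticalProb_lfib_le_of_table rule8 ((3397 : ℝ) / 10000) ((5001 : ℝ) / 10000)
    (by norm_num) (by norm_num) (by norm_num) (by norm_num)
    (by rw [ZMod.card]; norm_num) htab
  simpa [rule8] using h

/-- **`p_c^site(ℤ^5) ≤ 0.3397`** (usable-set T-fibre comparison with complete bipartite fibres `K_{4,4}`). -/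
theorem siteCriticalProb_Z5_le_3397 : siteCriticalProb (zdGraph 5) (0 : Site 5) ≤ 0.3397 :=
  siteCriticalProb_Z5_le_lfib.trans (siteCriticalProb_lfib5_le.trans (by norm_num))

/-- **`p_c^site(ℤ^d) ≤ 0.3397` for every `d ≥ 5`.** -/
theorem siteCriticalProb_zd_le_3397 {d : ℕ} (hd : 5 ≤ d) : siteCriticalProb (zdGraph d) (0 : Site d) ≤ 0.3397 :=
  (AxisGrouping.siteCriticalProb_zd_anti hd).trans siteCriticalProb_Z5_le_3397

end UFib

end Summit.CriticalPhenomena.PercolationContinuityZ3.Theorems.Pcint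

end
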